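import Literature.AlgebraicGeometry.ModuliOfAbelianVarieties.SiegelAdmissibleMarkingUnique
import Literature.AlgebraicGeometry.ModuliOfAbelianVarieties.SiegelAdmissibleOfIso
import Literature.AlgebraicGeometry.ModuliOfAbelianVarieties.SiegelCMConjugationHomIntertwines
import Literature.AlgebraicGeometry.Motives.AbelianVarietyHomTorsionDetermined
import HarnessLib

/-!
# Rigidity of an admissibly marked fibre: an automorphism fixing the level-`N` structure (`N ≥ 3`) and the polarisation
# witness is the identity («lemma of Serre»; [Mumford–Fogarty–Kirwan] Ch. 7 §3, [Milne 2005] Thm. 6.11 + Lemma 5.13, [Lange 2023] Rem. 3.1.10 (2))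

Topic `AlgebraicGeometry/ModuliOfAbelianVarieties`; namespace `Literature.AlgebraicGeometry.ModuliOfAbelianVarieties`.
THEOREMS ONLY (no definition, no named fact, no instance, no `sorry`; net Literature debt 0).  Cell `hodgecm-mathlib` (D-0151), FLOOR 0, P6
door (E) of `stub_RGD`, E6 step 8 — **E6-γ-B**, the rigidity input of the descent `ℂ → Fᵢ` of the `𝒪_F`-action (★ B-γ
`existsUnique_hom_pullback_map_eq_of_forall_exists_fieldPoint` wants, at one point per connected component, that the CANONICAL identification
`g : (A_x)^σ ≅ A_{x^σ}` (★ `conjFibreIso`) intertwine the two readings; the CM isogeny `f̃` does (★ E6-γ-A `conjugate_comp_eq_comp_of_adelicCongr`,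
p847080), and `u := f̃ ≫ g⁻¹` is an automorphism of the TRIPLE at `x^σ`, hence trivial by this file — so `g = f̃`).  `--supports stmt-HodgeConjecture-24832`,
count-neutral; HC_CM is proved only modulo the printed citations until rung 0 closes.

* §1 **`SiegelAdelicMarking.map_iso_hom_r_eq_of_lifts`** / **`SiegelAdelicMarking.iso_hom_eq_id_of_lifts`** — in the binders of ★ MRK-UNIQ
  `SiegelAdelicMarking.r_eq_r_of_lifts` VERBATIM (a fibre `B_s` of an abelian scheme with dual pair `D`, polarisation `lam`, level-`N` structure
  `φ`, `N ≥ 3`; an admissibility datum `(m, Θ, Λ)` at `(Z, r)`: marking, `λ`-witness `IsLambdaOfAt`, symplectic-lift tower read through `m`):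
  an automorphism `u : B_s ≅ B_s` which FIXES THE LEVEL SECTIONS (`u(φᵢ(s)) = φᵢ(s)`) and PULLS THE `λ`-WITNESS BACK TO A `λ`-WITNESS
  (`IsLambdaOfAt … (u⁻¹)^*Θ`) fixes every `m.r v`, hence is the identity.  Proof: push `(m, Θ, Λ)` forward along `u` (★ `SiegelAdelicMarking.exists_of_iso`,
  ★ `LevelStructure.SymplecticLift.exists_transport_lift_eq`) to a second admissibility datum at the SAME `(Z, r)`; MRK-UNIQ (free action of `Γ_δ(N)`
  on `𝔥_g`, Minkowski ∕ Serre) gives `u ∘ m.r = m.r`; the `m.r v` exhaust the torsion (★ `exists_r_eq_of_mem_torsionPoints`) and a homomorphism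
  of abelian varieties is determined on torsion points (★ `hom_eq_of_forall_torsionPoints_map`, [MumfordAV1970] §19 Thm. 3).
* §2 **`SiegelAdelicMarking.conjugate_comp_eq_comp_of_iso_of_lifts`** — E6-γ-A + E6-γ-B composed: two isomorphisms `e₁ = g`, `e₂ = f̃ : A^τ ≅ B_s` onto an
  admissibly marked fibre whose quotient `g⁻¹ ≫ f̃` satisfies the two clauses of §1, `f̃` with the CM torsion reading of ★ `CMConjugationIsogenyAll`;
  then `g = f̃` and **`y^τ ≫ g = g ≫ y′`** for endomorphisms reading through the markings by one congruence-preserving `ℓ`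
  (ED. 2: `…_of_iso_of_lifts₂`, a congruence-preserving PAIR `(ℓ, ℓ′)`).
* §3 (ED. 3) **`SiegelAdelicMarking.iso_hom_eq_id_of_symplecticLift`** / **`iso_hom_eq_iso_hom_of_symplecticLift`** — rigidity from a SECOND symplectic
  lift `Λ′` of the SAME witness `Θ` whose tower is `u ∘ Λ` read through `m` (no `λ`-transport; the E6-γ shape).

## References
* [MumfordFogartyKirwan1994] D. Mumford, J. Fogarty, F. Kirwan, *Geometric Invariant Theory*, 3rd ed. (1994), Ch. 7 §3 (lemma of Serre; p. 131).
* [Milne2005ShimuraVarieties] J. S. Milne, *Introduction to Shimura varieties* (2005), §6 Thm. 6.11 pp. 74–75, Lemma 5.13 p. 57, §14 Prop. 14.12 p. 125.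
* [Lange2023AbelianVarietiesComplex] H. Lange, *Abelian Varieties over the Complex Numbers* (2023), §3.1.3 Remark 3.1.10 (2).
* [MumfordAV1970] D. Mumford, *Abelian Varieties* (1970), §19 Thm. 3 and Cor. 1.
-/

set_option autoImplicit false

noncomputable section

open Matrix CategoryTheory AlgebraicGeometry
open Literature.AlgebraicGeometry.Motives (AbelianVariety AlgPoints CartierDivisor)
open Literature.AlgebraicGeometry.AbelianSchemes (AbelianSchemeOver)
open Literature.NumberTheory.Automorphic (siegelUpperHalfSpace)

namespace Literature.AlgebraicGeometry.ModuliOfAbelianVarieties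

open SiegelModuli

variable {g : ℕ} {δ : Fin g → ℕ}

/-! ### §1. Rigidity: an automorphism of an admissibly marked fibre fixing the level sections and the `λ`-witness is the identity -/

section Rigidity

variable {N : ℕ} {S : Scheme} {B : AbelianSchemeOver S} {s : Spec (CommRingCat.of ℂ) ⟶ S} {D : B.DualPair} {lam : B.X ⟶ D.hat.X}
  {φ : B.LevelStructure g N} {Θ : CartierDivisor (B.fibre s).toAbelianVariety.X.left}
  {r : gspFinAdelic δ} {Z : Matrix (Fin g) (Fin g) ℂ}

/-- **Rigidity on the torsion parametrisation** ([MumfordFogartyKirwan1994] Ch. 7 §3 «lemma of Serre»; [Milne2005ShimuraVarieties] Thm. 6.11 with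
Lemma 5.13): for an admissibility datum `(m, Θ, Λ)` of the fibre `B_s` at `(Z, r)` (`N ≥ 3`) and an automorphism `u : B_s ≅ B_s` fixing the level
sections `φᵢ(s)` and pulling the `λ`-witness `Θ` back (along `u⁻¹`) to a `λ`-witness, **`u(m.r v) = m.r v` for every `v ∈ ℚ^{2g}`** — the pushed-forward
datum `(u_* m, (u⁻¹)^*Θ, u ∘ Λ)` is a second admissibility datum at the same `(Z, r)`, and ★ MRK-UNIQ `r_eq_r_of_lifts` identifies the two torsion
parametrisations. [cite: MumfordFogartyKirwan1994, Ch. 7 §3 (lemma of Serre)] [cite: Milne2005ShimuraVarieties, §6 Thm. 6.11 pp. 74–75; Lemma 5.13 p. 57]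
[cite: Lange2023AbelianVarietiesComplex, §3.1.3 Remark 3.1.10 (2)] -/
theorem SiegelAdelicMarking.map_iso_hom_r_eq_of_lifts (hg : 0 < g) (hδ : IsPolarizationType δ) (hN : 3 ≤ N)
    (hr : r ∈ principalLevelSubgroup δ 1) (hZ : Z ∈ siegelUpperHalfSpace g)
    (m : SiegelAdelicMarking ⟨jOfSiegel δ Z, SiegelComplexRecordSystem.jOfSiegel_mem_C0pm hδ.1 hZ⟩ r (B.fibre s).toAbelianVariety)
    (Λ : φ.SymplecticLift s Θ δ) (hΘl : B.IsLambdaOfAt s D lam Θ)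
    (hΛ : ∀ ⦃M : ℕ⦄, N ∣ M → M ≠ 0 → ∀ (x : Fin g ⊕ Fin g → ZMod M) (v : Fin g ⊕ Fin g → ℚ),
      AdelicCongr ((r⁻¹ : gspFinAdelic δ) : GL (Fin g ⊕ Fin g) finAdeleQ) 1 v (fun i => ((x i).val : ℚ) / M) →
        ((Λ.lift M (Multiplicative.ofAdd x)) : (B.fibre s).toAbelianVariety.Points ℂ) = m.r v)
    (u : (B.fibre s).toAbelianVariety ≅ (B.fibre s).toAbelianVariety)
    (hu : ∀ i : Fin g ⊕ Fin g, AlgPoints.map u.hom.hom.hom.hom (B.restrictPt s (φ.σ i)) = B.restrictPt s (φ.σ i))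
    (huΘ : haveI := AbelianVariety.isDominant_toSchemeHom_iso_hom u.symm
      B.IsLambdaOfAt s D lam (Θ.pullback (AbelianVariety.Hom.toSchemeHom u.symm.hom)))
    (v : Fin g ⊕ Fin g → ℚ) :
    AlgPoints.map u.hom.hom.hom.hom (m.r v) = m.r v := by
  haveI := AbelianVariety.isDominant_toSchemeHom_iso_hom u.symm
  -- (1) push the marking forward along `u`: a marking by the same `[J(Z), r]` with `r′ = u ∘ r`
  obtain ⟨m', -, hm'⟩ := m.exists_of_iso u
  -- (2) `u⁻¹` carries the level sections to the level sections
  have he : ∀ i : Fin g ⊕ Fin g,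
      AlgPoints.map u.symm.hom.hom.hom.hom (B.restrictPt s (φ.σ i)) = B.restrictPt s (φ.σ i) := by
    intro i
    have h := congrArg (AlgPoints.map u.inv.hom.hom.hom) (hu i)
    rw [← AlgPoints.map_comp_apply] at h
    have hc : u.hom.hom.hom.hom ≫ u.inv.hom.hom.hom = (u.hom ≫ u.inv).hom.hom.hom := rfl
    rw [hc, u.hom_inv_id] at h
    simp only [AbelianVariety.id_hom] at h
    exact h.symm
  -- (3) transport the symplectic-lift tower along `u⁻¹`: `lift′_M = u ∘ lift_M`
  obtain ⟨Λ', -, hΛ'⟩ :=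
    AbelianSchemeOver.LevelStructure.SymplecticLift.exists_transport_lift_eq (φ := φ) (φ' := φ) u.symm he Λ
  have hΛ't : ∀ ⦃M : ℕ⦄, N ∣ M → M ≠ 0 → ∀ (x : Fin g ⊕ Fin g → ZMod M) (w : Fin g ⊕ Fin g → ℚ),
      AdelicCongr ((r⁻¹ : gspFinAdelic δ) : GL (Fin g ⊕ Fin g) finAdeleQ) 1 w (fun i => ((x i).val : ℚ) / M) →
        ((Λ'.lift M (Multiplicative.ofAdd x)) : (B.fibre s).toAbelianVariety.Points ℂ) = m'.r w := by
    intro M hNM hM0 x w hw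
    rw [hΛ', hΛ hNM hM0 x w hw, hm' w]
    rfl
  -- (4) MRK-UNIQ at the same `(Z, r)`
  rw [← hm' v]
  exact (SiegelAdelicMarking.r_eq_r_of_lifts hg hδ hN hr hZ m Λ hΘl hΛ m' Λ' huΘ hΛ't v).symm

/-- **RIGIDITY (lemma of Serre) for an admissibly marked fibre**: under the hypotheses of `map_iso_hom_r_eq_of_lifts` the automorphism `u` IS THE
IDENTITY — no automorphism of `(A, λ, η)` with `η` of level `N ≥ 3` survives ([MumfordFogartyKirwan1994] Ch. 7 §3; [Milne2005ShimuraVarieties] Thm. 6.11).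
The `m.r v` exhaust the torsion points (★ `exists_r_eq_of_mem_torsionPoints`) and a homomorphism of abelian varieties is determined by its values on
torsion points ([MumfordAV1970] §19 Thm. 3; ★ `hom_eq_of_forall_torsionPoints_map`).
[cite: MumfordFogartyKirwan1994, Ch. 7 §3 (lemma of Serre)] [cite: Milne2005ShimuraVarieties, §6 Thm. 6.11 pp. 74–75] [cite: MumfordAV1970, §19 Thm. 3 and Cor. 1] -/
theorem SiegelAdelicMarking.iso_hom_eq_id_of_lifts (hg : 0 < g) (hδ : IsPolarizationType δ) (hN : 3 ≤ N)
    (hr : r ∈ principalLevelSubgroup δ 1) (hZ : Z ∈ siegelUpperHalfSpace g)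
    (m : SiegelAdelicMarking ⟨jOfSiegel δ Z, SiegelComplexRecordSystem.jOfSiegel_mem_C0pm hδ.1 hZ⟩ r (B.fibre s).toAbelianVariety)
    (Λ : φ.SymplecticLift s Θ δ) (hΘl : B.IsLambdaOfAt s D lam Θ)
    (hΛ : ∀ ⦃M : ℕ⦄, N ∣ M → M ≠ 0 → ∀ (x : Fin g ⊕ Fin g → ZMod M) (v : Fin g ⊕ Fin g → ℚ),
      AdelicCongr ((r⁻¹ : gspFinAdelic δ) : GL (Fin g ⊕ Fin g) finAdeleQ) 1 v (fun i => ((x i).val : ℚ) / M) →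
        ((Λ.lift M (Multiplicative.ofAdd x)) : (B.fibre s).toAbelianVariety.Points ℂ) = m.r v)
    (u : (B.fibre s).toAbelianVariety ≅ (B.fibre s).toAbelianVariety)
    (hu : ∀ i : Fin g ⊕ Fin g, AlgPoints.map u.hom.hom.hom.hom (B.restrictPt s (φ.σ i)) = B.restrictPt s (φ.σ i))
    (huΘ : haveI := AbelianVariety.isDominant_toSchemeHom_iso_hom u.symm
      B.IsLambdaOfAt s D lam (Θ.pullback (AbelianVariety.Hom.toSchemeHom u.symm.hom))) :
    u.hom = 𝟙 _ := by
  refine AbelianVariety.hom_eq_of_forall_torsionPoints_map _ _ fun n hn Q hQ => ?_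
  obtain ⟨v, rfl⟩ := m.exists_r_eq_of_mem_torsionPoints (Nat.pos_iff_ne_zero.1 hn) hQ
  rw [SiegelAdelicMarking.map_iso_hom_r_eq_of_lifts hg hδ hN hr hZ m Λ hΘl hΛ u hu huΘ v]
  simp only [AbelianVariety.id_hom]
  rfl

end Rigidity

/-! ### §2. Two isomorphisms onto an admissibly marked fibre that agree on the level sections and the `λ`-witness coincide; E6-γ-A composed -/

section TwoIsos

variable {N : ℕ} {S : Scheme} {B : AbelianSchemeOver S} {s : Spec (CommRingCat.of ℂ) ⟶ S} {D : B.DualPair} {lam : B.X ⟶ D.hat.X}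
  {φ : B.LevelStructure g N} {Θ : CartierDivisor (B.fibre s).toAbelianVariety.X.left}
  {r : gspFinAdelic δ} {Z : Matrix (Fin g) (Fin g) ℂ} {A₁ : AbelianVariety ℂ}

/-- **Two isomorphisms `e₁, e₂ : A₁ ≅ B_s` onto an admissibly marked fibre COINCIDE as soon as `e₁⁻¹ ≫ e₂` fixes the level sections and pulls the
`λ`-witness back to a `λ`-witness** (rigidity `iso_hom_eq_id_of_lifts` applied to `u := e₁⁻¹ ≫ e₂`).  In E6-γ: `e₁` = the canonical ★ `conjFibreIso`,
`e₂` = the CM isogeny of ★ `CMConjugationIsogenyAll` made an isomorphism of triples (W3 H3 ★ `exists_fibreIso_isBaseChangeVia_id_triple`).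
[cite: MumfordFogartyKirwan1994, Ch. 7 §3 (lemma of Serre)] [cite: Milne2005ShimuraVarieties, §6 Thm. 6.11 pp. 74–75; §14 Prop. 14.12 p. 125] -/
theorem SiegelAdelicMarking.iso_hom_eq_iso_hom_of_lifts (hg : 0 < g) (hδ : IsPolarizationType δ) (hN : 3 ≤ N)
    (hr : r ∈ principalLevelSubgroup δ 1) (hZ : Z ∈ siegelUpperHalfSpace g)
    (m : SiegelAdelicMarking ⟨jOfSiegel δ Z, SiegelComplexRecordSystem.jOfSiegel_mem_C0pm hδ.1 hZ⟩ r (B.fibre s).toAbelianVariety)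
    (Λ : φ.SymplecticLift s Θ δ) (hΘl : B.IsLambdaOfAt s D lam Θ)
    (hΛ : ∀ ⦃M : ℕ⦄, N ∣ M → M ≠ 0 → ∀ (x : Fin g ⊕ Fin g → ZMod M) (v : Fin g ⊕ Fin g → ℚ),
      AdelicCongr ((r⁻¹ : gspFinAdelic δ) : GL (Fin g ⊕ Fin g) finAdeleQ) 1 v (fun i => ((x i).val : ℚ) / M) →
        ((Λ.lift M (Multiplicative.ofAdd x)) : (B.fibre s).toAbelianVariety.Points ℂ) = m.r v)
    (e₁ e₂ : A₁ ≅ (B.fibre s).toAbelianVariety)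
    (hu : ∀ i : Fin g ⊕ Fin g, AlgPoints.map (e₁.symm ≪≫ e₂).hom.hom.hom.hom (B.restrictPt s (φ.σ i)) = B.restrictPt s (φ.σ i))
    (huΘ : haveI := AbelianVariety.isDominant_toSchemeHom_iso_hom (e₁.symm ≪≫ e₂).symm
      B.IsLambdaOfAt s D lam (Θ.pullback (AbelianVariety.Hom.toSchemeHom (e₁.symm ≪≫ e₂).symm.hom))) :
    e₂.hom = e₁.hom := by
  have h1 : (e₁.symm ≪≫ e₂).hom = 𝟙 _ := SiegelAdelicMarking.iso_hom_eq_id_of_lifts hg hδ hN hr hZ m Λ hΘl hΛ (e₁.symm ≪≫ e₂) hu huΘ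
  have h2 : e₁.inv ≫ e₂.hom = 𝟙 _ := by simpa only [Iso.trans_hom, Iso.symm_hom] using h1
  calc e₂.hom = e₁.hom ≫ (e₁.inv ≫ e₂.hom) := by rw [Iso.hom_inv_id_assoc]
    _ = e₁.hom := by rw [h2, Category.comp_id]

/-- **E6-γ (A + B composed) — the CANONICAL identification intertwines.**  Source: a complex abelian variety `A₁` marked by `m₁` (`[J₁, a₁]`) and a
field automorphism `τ`; target: an admissibly marked fibre `B_s` (`(m, Θ, Λ)` at `(Z, r)`, level `N ≥ 3`); two isomorphisms `e₁ e₂ : A₁^τ ≅ B_s` with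
`e₁⁻¹ ≫ e₂` fixing the level sections and the `λ`-witness (so `e₂ = e₁`, `iso_hom_eq_iso_hom_of_lifts`), `e₂` with the CM torsion reading
`e₂((m₁.r v)^τ) = m.r w` for `AdelicCongr B₀ B₀′ v w` (★ `CMConjugationIsogenyAll`); endomorphisms `y` of `A₁` and `y′` of `B_s` reading through the
markings by one congruence-preserving rational matrix `ℓ`.  THEN **`y^τ ≫ e₁ = e₁ ≫ y′`** (★ E6-γ-A `conjugate_comp_eq_comp_of_adelicCongr` for `e₂`,
transported to `e₁`) — B-γ's fibre hypothesis at a special point, for the canonical `e₁` = ★ `conjFibreIso`.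
[cite: Milne2005ShimuraVarieties, §14 Prop. 14.12 p. 125 and §11 Thm. 11.2 p. 108] [cite: Shimura1998, §21.4 p. 192] [cite: MumfordFogartyKirwan1994, Ch. 7 §3 (lemma of Serre)] -/
theorem SiegelAdelicMarking.conjugate_comp_eq_comp_of_iso_of_lifts (hg : 0 < g) (hδ : IsPolarizationType δ) (hN : 3 ≤ N)
    (hr : r ∈ principalLevelSubgroup δ 1) (hZ : Z ∈ siegelUpperHalfSpace g)
    (m : SiegelAdelicMarking ⟨jOfSiegel δ Z, SiegelComplexRecordSystem.jOfSiegel_mem_C0pm hδ.1 hZ⟩ r (B.fibre s).toAbelianVariety)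
    (Λ : φ.SymplecticLift s Θ δ) (hΘl : B.IsLambdaOfAt s D lam Θ)
    (hΛ : ∀ ⦃M : ℕ⦄, N ∣ M → M ≠ 0 → ∀ (x : Fin g ⊕ Fin g → ZMod M) (v : Fin g ⊕ Fin g → ℚ),
      AdelicCongr ((r⁻¹ : gspFinAdelic δ) : GL (Fin g ⊕ Fin g) finAdeleQ) 1 v (fun i => ((x i).val : ℚ) / M) →
        ((Λ.lift M (Multiplicative.ofAdd x)) : (B.fibre s).toAbelianVariety.Points ℂ) = m.r v)
    (τ : ℂ ≃+* ℂ) {J₁ : C0pm δ} {a₁ : gspFinAdelic δ} (m₁ : SiegelAdelicMarking J₁ a₁ A₁)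
    (e₁ e₂ : A₁.conjugate τ ≅ (B.fibre s).toAbelianVariety)
    (hu : ∀ i : Fin g ⊕ Fin g, AlgPoints.map (e₁.symm ≪≫ e₂).hom.hom.hom.hom (B.restrictPt s (φ.σ i)) = B.restrictPt s (φ.σ i))
    (huΘ : haveI := AbelianVariety.isDominant_toSchemeHom_iso_hom (e₁.symm ≪≫ e₂).symm
      B.IsLambdaOfAt s D lam (Θ.pullback (AbelianVariety.Hom.toSchemeHom (e₁.symm ≪≫ e₂).symm.hom)))
    (B₀ B₀' : GL (Fin g ⊕ Fin g) finAdeleQ)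
    (hf : ∀ v w : Fin g ⊕ Fin g → ℚ, AdelicCongr B₀ B₀' v w →
      AlgPoints.map e₂.hom.hom.hom.hom (A₁.conjPoints τ (m₁.r v)) = m.r w)
    (ℓ : Matrix (Fin g ⊕ Fin g) (Fin g ⊕ Fin g) ℚ)
    (hℓ : ∀ v w : Fin g ⊕ Fin g → ℚ, AdelicCongr B₀ B₀' v w → AdelicCongr B₀ B₀' (ℓ *ᵥ v) (ℓ *ᵥ w))
    (y : A₁ ⟶ A₁) (hy : ∀ v : Fin g ⊕ Fin g → ℚ, AlgPoints.map y.hom.hom.hom (m₁.r v) = m₁.r (ℓ *ᵥ v))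
    (y' : (B.fibre s).toAbelianVariety ⟶ (B.fibre s).toAbelianVariety)
    (hy' : ∀ w : Fin g ⊕ Fin g → ℚ, AlgPoints.map y'.hom.hom.hom (m.r w) = m.r (ℓ *ᵥ w)) :
    AbelianVariety.Hom.conjugate τ y ≫ e₁.hom = e₁.hom ≫ y' := by
  rw [← SiegelAdelicMarking.iso_hom_eq_iso_hom_of_lifts hg hδ hN hr hZ m Λ hΘl hΛ e₁ e₂ hu huΘ]
  exact SiegelAdelicMarking.conjugate_comp_eq_comp_of_adelicCongr τ m₁ m B₀ B₀' e₂.hom hf ℓ hℓ y hy y' hy'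

/-- **E6-γ (A + B composed), TWO RATIONAL REPRESENTATIONS**: as `conjugate_comp_eq_comp_of_iso_of_lifts`, with `y` reading `ℓ` through `m₁` and
`y′` reading `ℓ′` through `m` for a congruence-preserving PAIR `(ℓ, ℓ′)` (★ `conjugate_comp_eq_comp_of_adelicCongr₂`) — the form met when the two
admissible markings sit at different period points (movers `q_a ≠ q_{a′}`). [cite: Milne2005ShimuraVarieties, §14 Prop. 14.12 p. 125 and §11 Thm. 11.2 p. 108]
[cite: Shimura1998, §21.4 p. 192] [cite: MumfordFogartyKirwan1994, Ch. 7 §3 (lemma of Serre)] -/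
theorem SiegelAdelicMarking.conjugate_comp_eq_comp_of_iso_of_lifts₂ (hg : 0 < g) (hδ : IsPolarizationType δ) (hN : 3 ≤ N)
    (hr : r ∈ principalLevelSubgroup δ 1) (hZ : Z ∈ siegelUpperHalfSpace g)
    (m : SiegelAdelicMarking ⟨jOfSiegel δ Z, SiegelComplexRecordSystem.jOfSiegel_mem_C0pm hδ.1 hZ⟩ r (B.fibre s).toAbelianVariety)
    (Λ : φ.SymplecticLift s Θ δ) (hΘl : B.IsLambdaOfAt s D lam Θ)
    (hΛ : ∀ ⦃M : ℕ⦄, N ∣ M → M ≠ 0 → ∀ (x : Fin g ⊕ Fin g → ZMod M) (v : Fin g ⊕ Fin g → ℚ),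
      AdelicCongr ((r⁻¹ : gspFinAdelic δ) : GL (Fin g ⊕ Fin g) finAdeleQ) 1 v (fun i => ((x i).val : ℚ) / M) →
        ((Λ.lift M (Multiplicative.ofAdd x)) : (B.fibre s).toAbelianVariety.Points ℂ) = m.r v)
    (τ : ℂ ≃+* ℂ) {J₁ : C0pm δ} {a₁ : gspFinAdelic δ} (m₁ : SiegelAdelicMarking J₁ a₁ A₁)
    (e₁ e₂ : A₁.conjugate τ ≅ (B.fibre s).toAbelianVariety)
    (hu : ∀ i : Fin g ⊕ Fin g, AlgPoints.map (e₁.symm ≪≫ e₂).hom.hom.hom.hom (B.restrictPt s (φ.σ i)) = B.restrictPt s (φ.σ i))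
    (huΘ : haveI := AbelianVariety.isDominant_toSchemeHom_iso_hom (e₁.symm ≪≫ e₂).symm
      B.IsLambdaOfAt s D lam (Θ.pullback (AbelianVariety.Hom.toSchemeHom (e₁.symm ≪≫ e₂).symm.hom)))
    (B₀ B₀' : GL (Fin g ⊕ Fin g) finAdeleQ)
    (hf : ∀ v w : Fin g ⊕ Fin g → ℚ, AdelicCongr B₀ B₀' v w →
      AlgPoints.map e₂.hom.hom.hom.hom (A₁.conjPoints τ (m₁.r v)) = m.r w)
    (ℓ ℓ' : Matrix (Fin g ⊕ Fin g) (Fin g ⊕ Fin g) ℚ)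
    (hℓ : ∀ v w : Fin g ⊕ Fin g → ℚ, AdelicCongr B₀ B₀' v w → AdelicCongr B₀ B₀' (ℓ *ᵥ v) (ℓ' *ᵥ w))
    (y : A₁ ⟶ A₁) (hy : ∀ v : Fin g ⊕ Fin g → ℚ, AlgPoints.map y.hom.hom.hom (m₁.r v) = m₁.r (ℓ *ᵥ v))
    (y' : (B.fibre s).toAbelianVariety ⟶ (B.fibre s).toAbelianVariety)
    (hy' : ∀ w : Fin g ⊕ Fin g → ℚ, AlgPoints.map y'.hom.hom.hom (m.r w) = m.r (ℓ' *ᵥ w)) :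
    AbelianVariety.Hom.conjugate τ y ≫ e₁.hom = e₁.hom ≫ y' := by
  rw [← SiegelAdelicMarking.iso_hom_eq_iso_hom_of_lifts hg hδ hN hr hZ m Λ hΘl hΛ e₁ e₂ hu huΘ]
  exact SiegelAdelicMarking.conjugate_comp_eq_comp_of_adelicCongr₂ τ m₁ m B₀ B₀' e₂.hom hf ℓ ℓ' hℓ y hy y' hy'

end TwoIsos

/-! ### §3. Rigidity from a SECOND SYMPLECTIC LIFT of the same witness (no `λ`-transport): the shape met in E6-γ -/

section SameWitness

variable {N : ℕ} {S : Scheme} {B : AbelianSchemeOver S} {s : Spec (CommRingCat.of ℂ) ⟶ S} {D : B.DualPair} {lam : B.X ⟶ D.hat.X}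
  {φ : B.LevelStructure g N} {Θ : CartierDivisor (B.fibre s).toAbelianVariety.X.left}
  {r : gspFinAdelic δ} {Z : Matrix (Fin g) (Fin g) ℂ}

/-- **RIGIDITY from a second symplectic lift of the SAME witness `Θ`** ([MumfordFogartyKirwan1994] Ch. 7 §3 «lemma of Serre»; [Milne2005ShimuraVarieties]
Thm. 6.11): for an admissibility datum `(m, Θ, Λ)` at `(Z, r)` (`N ≥ 3`) and an automorphism `u : B_s ≅ B_s`, if some symplectic lift `Λ′` of `φ` at `s` FOR THE
SAME `Θ` has tower `u ∘ Λ` READ THROUGH `m` (`Λ′_M x = u (m.r v)` whenever `r⁻¹ v̂ ≡ x/M`), then `u = 𝟙`.  The second admissibility datum is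
`(u_* m, Θ, Λ′)` with the SAME `λ`-witness, so ★ MRK-UNIQ `r_eq_r_of_lifts` needs no transport of `Θ`; in E6-γ the lift `Λ′` is a ★ `reindex` of the organ's lift by
the `K_δ(N)`-tower through which `u = conjFibreIso⁻¹ ≫ (CM isogeny)` acts (★ `exists_mem_principalLevelSubgroup_one_lift_eq` + ★ `map_conjPoints_lift_eq_lift_reindex_mulVec`
+ ★ `exists_conjTransport_lift_eq`).  (The level clause `u(φᵢ(s)) = φᵢ(s)` is then automatic from `Λ′.lift_level`.)
[cite: MumfordFogartyKirwan1994, Ch. 7 §3 (lemma of Serre)] [cite: Milne2005ShimuraVarieties, §6 Thm. 6.11 pp. 74–75] [cite: MumfordAV1970, §19 Thm. 3 and Cor. 1] -/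
theorem SiegelAdelicMarking.iso_hom_eq_id_of_symplecticLift (hg : 0 < g) (hδ : IsPolarizationType δ) (hN : 3 ≤ N)
    (hr : r ∈ principalLevelSubgroup δ 1) (hZ : Z ∈ siegelUpperHalfSpace g)
    (m : SiegelAdelicMarking ⟨jOfSiegel δ Z, SiegelComplexRecordSystem.jOfSiegel_mem_C0pm hδ.1 hZ⟩ r (B.fibre s).toAbelianVariety)
    (Λ : φ.SymplecticLift s Θ δ) (hΘl : B.IsLambdaOfAt s D lam Θ)
    (hΛ : ∀ ⦃M : ℕ⦄, N ∣ M → M ≠ 0 → ∀ (x : Fin g ⊕ Fin g → ZMod M) (v : Fin g ⊕ Fin g → ℚ),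
      AdelicCongr ((r⁻¹ : gspFinAdelic δ) : GL (Fin g ⊕ Fin g) finAdeleQ) 1 v (fun i => ((x i).val : ℚ) / M) →
        ((Λ.lift M (Multiplicative.ofAdd x)) : (B.fibre s).toAbelianVariety.Points ℂ) = m.r v)
    (u : (B.fibre s).toAbelianVariety ≅ (B.fibre s).toAbelianVariety)
    (Λ' : φ.SymplecticLift s Θ δ)
    (hΛ' : ∀ ⦃M : ℕ⦄, N ∣ M → M ≠ 0 → ∀ (x : Fin g ⊕ Fin g → ZMod M) (v : Fin g ⊕ Fin g → ℚ),
      AdelicCongr ((r⁻¹ : gspFinAdelic δ) : GL (Fin g ⊕ Fin g) finAdeleQ) 1 v (fun i => ((x i).val : ℚ) / M) →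
        ((Λ'.lift M (Multiplicative.ofAdd x)) : (B.fibre s).toAbelianVariety.Points ℂ) =
          AlgPoints.map u.hom.hom.hom.hom (m.r v)) :
    u.hom = 𝟙 _ := by
  -- the pushed-forward marking `u_* m` reads the tower `Λ′`
  obtain ⟨m', -, hm'⟩ := m.exists_of_iso u
  have hΛ't : ∀ ⦃M : ℕ⦄, N ∣ M → M ≠ 0 → ∀ (x : Fin g ⊕ Fin g → ZMod M) (w : Fin g ⊕ Fin g → ℚ),
      AdelicCongr ((r⁻¹ : gspFinAdelic δ) : GL (Fin g ⊕ Fin g) finAdeleQ) 1 w (fun i => ((x i).val : ℚ) / M) →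
        ((Λ'.lift M (Multiplicative.ofAdd x)) : (B.fibre s).toAbelianVariety.Points ℂ) = m'.r w := by
    intro M hNM hM0 x w hw
    rw [hΛ' hNM hM0 x w hw, hm' w]
  -- MRK-UNIQ with the SAME witness on both sides: `m.r = m′.r = u ∘ m.r`
  have hfix : ∀ v, AlgPoints.map u.hom.hom.hom.hom (m.r v) = m.r v := fun v => by
    rw [← hm' v]
    exact (SiegelAdelicMarking.r_eq_r_of_lifts hg hδ hN hr hZ m Λ hΘl hΛ m' Λ' hΘl hΛ't v).symm
  refine AbelianVariety.hom_eq_of_forall_torsionPoints_map _ _ fun n hn Q hQ => ?_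
  obtain ⟨v, rfl⟩ := m.exists_r_eq_of_mem_torsionPoints (Nat.pos_iff_ne_zero.1 hn) hQ
  rw [hfix v]
  simp only [AbelianVariety.id_hom]
  rfl

/-- **Two isomorphisms onto an admissibly marked fibre coincide** when the tower `(e₁⁻¹ ≫ e₂) ∘ Λ` is a symplectic lift for the same witness
(`iso_hom_eq_id_of_symplecticLift` for `u := e₁⁻¹ ≫ e₂`). [cite: MumfordFogartyKirwan1994, Ch. 7 §3 (lemma of Serre)] [cite: Milne2005ShimuraVarieties, §6 Thm. 6.11 pp. 74–75] -/
theorem SiegelAdelicMarking.iso_hom_eq_iso_hom_of_symplecticLift (hg : 0 < g) (hδ : IsPolarizationType δ) (hN : 3 ≤ N)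
    (hr : r ∈ principalLevelSubgroup δ 1) (hZ : Z ∈ siegelUpperHalfSpace g)
    (m : SiegelAdelicMarking ⟨jOfSiegel δ Z, SiegelComplexRecordSystem.jOfSiegel_mem_C0pm hδ.1 hZ⟩ r (B.fibre s).toAbelianVariety)
    (Λ : φ.SymplecticLift s Θ δ) (hΘl : B.IsLambdaOfAt s D lam Θ)
    (hΛ : ∀ ⦃M : ℕ⦄, N ∣ M → M ≠ 0 → ∀ (x : Fin g ⊕ Fin g → ZMod M) (v : Fin g ⊕ Fin g → ℚ),
      AdelicCongr ((r⁻¹ : gspFinAdelic δ) : GL (Fin g ⊕ Fin g) finAdeleQ) 1 v (fun i => ((x i).val : ℚ) / M) →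
        ((Λ.lift M (Multiplicative.ofAdd x)) : (B.fibre s).toAbelianVariety.Points ℂ) = m.r v)
    {A₁ : AbelianVariety ℂ} (e₁ e₂ : A₁ ≅ (B.fibre s).toAbelianVariety)
    (Λ' : φ.SymplecticLift s Θ δ)
    (hΛ' : ∀ ⦃M : ℕ⦄, N ∣ M → M ≠ 0 → ∀ (x : Fin g ⊕ Fin g → ZMod M) (v : Fin g ⊕ Fin g → ℚ),
      AdelicCongr ((r⁻¹ : gspFinAdelic δ) : GL (Fin g ⊕ Fin g) finAdeleQ) 1 v (fun i => ((x i).val : ℚ) / M) →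
        ((Λ'.lift M (Multiplicative.ofAdd x)) : (B.fibre s).toAbelianVariety.Points ℂ) =
          AlgPoints.map (e₁.symm ≪≫ e₂).hom.hom.hom.hom (m.r v)) :
    e₂.hom = e₁.hom := by
  have h1 : (e₁.symm ≪≫ e₂).hom = 𝟙 _ :=
    SiegelAdelicMarking.iso_hom_eq_id_of_symplecticLift hg hδ hN hr hZ m Λ hΘl hΛ (e₁.symm ≪≫ e₂) Λ' hΛ'
  have h2 : e₁.inv ≫ e₂.hom = 𝟙 _ := by simpa only [Iso.trans_hom, Iso.symm_hom] using h1
  calc e₂.hom = e₁.hom ≫ (e₁.inv ≫ e₂.hom) := by rw [Iso.hom_inv_id_assoc]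
    _ = e₁.hom := by rw [h2, Category.comp_id]

end SameWitness

end Literature.AlgebraicGeometry.ModuliOfAbelianVarieties

end
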